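import Summits.CriticalPhenomena.Ising3DConformalLimit.Theses.GaussianScaleMixture
import HarnessLib

/-!
# Route GaussianScaleMixture — support item `OneAmplitudeIsotropy` (stmt-CriticalPhenomena-8369)

THEOREM-ONLY file (no definitions, no named facts). "O(3) from one amplitude": if
`K(x) = ∫ exp(-∑ᵢ sᵢ xᵢ²) ν(ds)` off the origin, with `ν` a measure on `ℝ³` invariant under the
coordinate permutations (exchangeable) and the Gaussian integrable at every `x ≠ 0`, then the single
amplitude identity `K(e₀) = K((e₀+e₁)/√2)` forces `K(Rx) = K(x)` for every linear isometry `R` of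
`ℝ³` and every `x ≠ 0`.

Proof (elementary, AM–GM): by exchangeability `∫ e^{-s₁} dν = ∫ e^{-s₀} dν = K(e₀)`, and
`(√2/2)² = 1/2` gives `K((e₀+e₁)/√2) = ∫ e^{-(s₀+s₁)/2} dν`; hence
`0 = K(e₀) - K((e₀+e₁)/√2) = ∫ [(e^{-s₀}+e^{-s₁})/2 - e^{-(s₀+s₁)/2}] dν
   = ∫ (e^{-s₀/2} - e^{-s₁/2})²/2 dν`,
so `s₀ = s₁` `ν`-a.e.; transporting this null set along the permutation `(0 2)` gives `s₂ = s₁`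
`ν`-a.e.; therefore `ν`-a.e. the integrand is `exp(-s₀‖x‖²)`, `K` is radial off the origin, and
`‖Rx‖ = ‖x‖`, `Rx ≠ 0` conclude. The octant hypothesis `ν{∃ i, sᵢ < 0} = 0` of the item is not
needed.
-/

noncomputable section

namespace Summit.CriticalPhenomena.Ising3DConformalLimit.Theorems

open MeasureTheory

/-- AM–GM defect of two exponentials as half a square:
`(e^{-a} + e^{-b})/2 - e^{-(a+b)/2} = (e^{-a/2} - e^{-b/2})²/2`. [folklore] -/
theorem oneAmplitude_exp_amgm_defect (a b : ℝ) :
    (Real.exp (-a) + Real.exp (-b)) / 2 - Real.exp (-((a + b) / 2))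
      = (Real.exp (-a / 2) - Real.exp (-b / 2)) ^ 2 / 2 := by
  have ha : Real.exp (-a) = Real.exp (-a / 2) ^ 2 := by
    rw [sq, ← Real.exp_add]; ring_nf
  have hb : Real.exp (-b) = Real.exp (-b / 2) ^ 2 := by
    rw [sq, ← Real.exp_add]; ring_nf
  have hab : Real.exp (-((a + b) / 2)) = Real.exp (-a / 2) * Real.exp (-b / 2) := by
    rw [← Real.exp_add]; ring_nf
  rw [ha, hb, hab]; ring

/-- The coordinate-permutation map `s ↦ s ∘ σ` of `ℝ³` is measurable. [folklore] -/
theorem oneAmplitude_measurable_comp_perm (σ : Equiv.Perm (Fin 3)) :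
    Measurable (fun s : Fin 3 → ℝ => s ∘ σ) :=
  measurable_pi_lambda _ (fun i => measurable_pi_apply (σ i))

/-- **`OneAmplitudeIsotropy` holds** (route `GaussianScaleMixture`, item stmt-CriticalPhenomena-8369):
for an exchangeable Gaussian scale mixture kernel `K` on `ℝ³ ∖ 0`, the one amplitude identity
`K(e₀) = K((e₀+e₁)/√2)` forces invariance of `K` under every linear isometry, off the origin.
[folklore] -/
theorem oneAmplitudeIsotropy_proof :
    Summit.CriticalPhenomena.Ising3DConformalLimit.Theses.GaussianScaleMixture.OneAmplitudeIsotropy := by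
  unfold Theses.GaussianScaleMixture.OneAmplitudeIsotropy
  intro K ν _ hσ hK hEq R x hx
  -- the three test points and the quadratic forms there
  have hc2 : (Real.sqrt 2 / 2) ^ 2 = 1 / 2 := by
    rw [div_pow, Real.sq_sqrt (by norm_num : (0:ℝ) ≤ 2)]; norm_num
  have hs0 : ∀ s : Fin 3 → ℝ,
      ∑ i, s i * ((EuclideanSpace.single 0 (1:ℝ) : EuclideanSpace ℝ (Fin 3)) i) ^ 2 = s 0 := by
    intro s; simp
  have hs1 : ∀ s : Fin 3 → ℝ,
      ∑ i, s i * ((EuclideanSpace.single 1 (1:ℝ) : EuclideanSpace ℝ (Fin 3)) i) ^ 2 = s 1 := by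
    intro s; simp
  have hsd : ∀ s : Fin 3 → ℝ,
      ∑ i, s i * ((EuclideanSpace.single 0 (Real.sqrt 2 / 2) +
        EuclideanSpace.single 1 (Real.sqrt 2 / 2) : EuclideanSpace ℝ (Fin 3)) i) ^ 2
        = (s 0 + s 1) / 2 := by
    intro s
    simp only [Fin.sum_univ_three, PiLp.add_apply, PiLp.single_apply]
    simp [hc2]
    ring
  have he0 : (EuclideanSpace.single 0 (1:ℝ) : EuclideanSpace ℝ (Fin 3)) ≠ 0 := by simp
  have he1 : (EuclideanSpace.single 1 (1:ℝ) : EuclideanSpace ℝ (Fin 3)) ≠ 0 := by simp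
  have hed : (EuclideanSpace.single 0 (Real.sqrt 2 / 2) +
      EuclideanSpace.single 1 (Real.sqrt 2 / 2) : EuclideanSpace ℝ (Fin 3)) ≠ 0 := by
    intro h
    have h' := congrArg (fun v : EuclideanSpace ℝ (Fin 3) => v 0) h
    simp only [PiLp.add_apply, PiLp.single_apply, PiLp.zero_apply] at h'
    simp at h'
  obtain ⟨hI0, hK0⟩ := hK _ he0
  obtain ⟨hI1, -⟩ := hK _ he1
  obtain ⟨hId, hKd⟩ := hK _ hed
  simp_rw [hs0] at hI0 hK0
  simp_rw [hs1] at hI1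
  simp_rw [hsd] at hId hKd
  -- exchangeability: ∫ e^{-s₁} = ∫ e^{-s₀}
  have hswap : ∫ s, Real.exp (-(s 1)) ∂ν = ∫ s, Real.exp (-(s 0)) ∂ν := by
    have h := integral_map (μ := ν)
      (oneAmplitude_measurable_comp_perm (Equiv.swap (0 : Fin 3) 1)).aemeasurable
      (f := fun s : Fin 3 → ℝ => Real.exp (-(s 0)))
      (Continuous.aestronglyMeasurable (by fun_prop))
    rw [hσ] at h
    rw [h]
    simp [Equiv.swap_apply_left]
  -- the AM–GM defect integrates to zero, hence vanishes a.e.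
  have hI01 : Integrable (fun s : Fin 3 → ℝ => (Real.exp (-(s 0)) + Real.exp (-(s 1))) / 2) ν :=
    (hI0.add hI1).div_const 2
  have hφ_int : Integrable (fun s : Fin 3 → ℝ =>
      (Real.exp (-(s 0)) + Real.exp (-(s 1))) / 2 - Real.exp (-((s 0 + s 1) / 2))) ν :=
    hI01.sub hId
  have hφ_nn : 0 ≤ fun s : Fin 3 → ℝ =>
      (Real.exp (-(s 0)) + Real.exp (-(s 1))) / 2 - Real.exp (-((s 0 + s 1) / 2)) := by
    intro s
    simp only [Pi.zero_apply]
    rw [oneAmplitude_exp_amgm_defect]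
    positivity
  have hφ_zero : ∫ s, ((Real.exp (-(s 0)) + Real.exp (-(s 1))) / 2
      - Real.exp (-((s 0 + s 1) / 2))) ∂ν = 0 := by
    rw [integral_sub hI01 hId, integral_div, integral_add hI0 hI1, hswap, ← hK0, ← hKd, ← hEq]
    ring
  have hae01 : ∀ᵐ s ∂ν, s 0 = s 1 := by
    have h := (integral_eq_zero_iff_of_nonneg hφ_nn hφ_int).mp hφ_zero
    filter_upwards [h] with s hs
    simp only [Pi.zero_apply] at hs
    rw [oneAmplitude_exp_amgm_defect] at hs
    have h2 : (Real.exp (-(s 0) / 2) - Real.exp (-(s 1) / 2)) ^ 2 = 0 := by linarith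
    have h3 : Real.exp (-(s 0) / 2) - Real.exp (-(s 1) / 2) = 0 := pow_eq_zero_iff (n := 2)
      (by norm_num) |>.mp h2
    have h4 : -(s 0) / 2 = -(s 1) / 2 := Real.exp_injective (sub_eq_zero.mp h3)
    linarith
  -- transport along the permutation (0 2): s₂ = s₁ a.e.
  have hae21 : ∀ᵐ s ∂ν, s 2 = s 1 := by
    have h' : ∀ᵐ s ∂(ν.map (fun s : Fin 3 → ℝ => s ∘ (Equiv.swap (0 : Fin 3) 2))), s 0 = s 1 := by
      rw [hσ]; exact hae01
    have h := ae_of_ae_map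
      (oneAmplitude_measurable_comp_perm (Equiv.swap (0 : Fin 3) 2)).aemeasurable h'
    filter_upwards [h] with s hs
    simpa [Equiv.swap_apply_def] using hs
  -- hence the integrand is radial a.e., and K is radial off the origin
  have hae : ∀ᵐ s ∂ν, ∀ y : EuclideanSpace ℝ (Fin 3),
      Real.exp (-∑ i, s i * (y i) ^ 2) = Real.exp (-(s 0 * ‖y‖ ^ 2)) := by
    filter_upwards [hae01, hae21] with s h01 h21
    intro y
    rw [EuclideanSpace.norm_sq_eq, Fin.sum_univ_three, Fin.sum_univ_three]
    simp only [Real.norm_eq_abs, sq_abs]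
    rw [h21, ← h01]
    congr 1
    ring
  have hKrad : ∀ y : EuclideanSpace ℝ (Fin 3), y ≠ 0 →
      K y = ∫ s, Real.exp (-(s 0 * ‖y‖ ^ 2)) ∂ν := by
    intro y hy
    rw [(hK y hy).2]
    exact integral_congr_ae (by filter_upwards [hae] with s hs using hs y)
  have hRx : R x ≠ 0 := fun h => hx (R.injective (by rw [h, map_zero]))
  rw [hKrad (R x) hRx, hKrad x hx, LinearIsometryEquiv.norm_map]

end Summit.CriticalPhenomena.Ising3DConformalLimit.Theorems
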